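import Summits.CriticalPhenomena.SAWScalingLimit.Theorems.SAWDefectDecoherencePickHalfPlaneDefs
import HarnessLib

/-!
# Crux `BoundaryClosureR` (stmt-CriticalPhenomena-14004), line `pick-half-plane`:
the central-symmetry mechanism behind the interior half of Claim D

Lead helper file (serves `stub_halfPlaneInputs`, interior half `HexNoInteriorMax`): the six
increments of a potential `H` of `F dz` around an interior hexagon are `m_k · F(edge_k)` with the
CENTRALLY SYMMETRIC half-edge vectors `m_{k+3} = −m_k` (`mvec`), so whenever the six edge values
are close to one non-zero number `P` (oscillation `< (√2/6)·‖P‖`, `noInteriorMax_of_oscillation`)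
the six real parts cannot all be `≤ 0`: opposite increments nearly cancel in sum, while among the
three line directions one carries a real part `≥ ‖P‖/√24` (frame identity
`re_sq_vecA_add`).  This is why the census of `HexNoInteriorMax` / `HexHullStrict` never fails in
the bulk (the observable varies slowly there) and locates the remaining content of the conjecture
at hexagons where the oscillation of `F` is comparable to `F` itself (boundary layer, zeros).
-/

noncomputable section

open scoped BigOperators ComplexConjugate
open Literature.Probability.LatticeModels Literature.Probability.RandomPlanarGeometry
open Literature.Probability.RandomPlanarGeometry.SAW
open Literature.Barriers.CriticalPhenomena Literature.Barriers.CriticalPhenomena.HexKernel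
open Summit.CriticalPhenomena.SAWScalingLimit.Theorems.PickHalfPlane

namespace Summit.CriticalPhenomena.SAWScalingLimit.Theorems.PickHalfPlane.Hexagon

/-- The six edge vectors of the hexagon around a site, `c(face_{k+1}) − c(face_k)`:
`b, −a, c, −b, a, −c`. [folklore] -/
def fvec : Fin 6 → ℂ := ![vecB, -vecA, vecC, -vecB, vecA, -vecC]

/-- The six half-edge vectors `m_k := mid(edge_k) − c(face_{k+1}) = −fvec_k/2` of the increments
`H(spoke_k) − H(s) = m_k · F(edge_k)`. [folklore] -/
def mvec (k : Fin 6) : ℂ := -fvec k / 2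

/-- `c(face_{k+1}) − c(face_k) = fvec k`. [folklore] -/
theorem hexCenter_face_succ_sub (x : Site 2) (k : Fin 6) :
    hexCenter (HexKernel.face x (k + 1)) - hexCenter (HexKernel.face x k) = fvec k := by
  fin_cases k <;>
    (simp [HexKernel.face, fvec, hexCenter_mk, HexKernel.triEmbed_sub, vecA, vecB, vecC]; ring)

/-- The half-edge vector of the `k`-th increment. [folklore] -/
theorem hexMidpoint_edge_sub (x : Site 2) (k : Fin 6) :
    hexMidpoint (HexKernel.edge x k) - hexCenter (HexKernel.face x (k + 1)) = mvec k := by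
  have h := hexCenter_face_succ_sub x k
  unfold HexKernel.edge mvec
  rw [hexMidpoint_mk]
  linear_combination (-1 / 2 : ℂ) * h

/-- **Central symmetry of the hexagon**: `m_{k+3} = −m_k`. [folklore] -/
theorem mvec_add_three (k : Fin 6) : mvec (k + 3) = -mvec k := by
  fin_cases k <;> simp [mvec, fvec] <;> ring

/-- `‖m_k‖² = 1/12` (the hexagon side is `1/√3`). [folklore] -/
theorem normSq_mvec (k : Fin 6) : Complex.normSq (mvec k) = 1 / 12 := by
  have h3 : Real.sqrt 3 * Real.sqrt 3 = 3 := Real.mul_self_sqrt (by norm_num)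
  fin_cases k <;>
    simp [mvec, fvec, vecA, vecB, vecC, Complex.normSq_apply] <;>
    nlinarith [h3]

/-- **Frame identity** of the three hexagon line directions (equiangular, length `1/√3`):
`Re(aP)² + Re(bP)² + Re(cP)² = ‖P‖²/2`. [folklore] -/
theorem re_sq_vecA_add (P : ℂ) :
    (vecA * P).re ^ 2 + (vecB * P).re ^ 2 + (vecC * P).re ^ 2 = Complex.normSq P / 2 := by
  have h3 : Real.sqrt 3 * Real.sqrt 3 = 3 := Real.mul_self_sqrt (by norm_num)
  simp [vecA, vecB, vecC, Complex.mul_re, Complex.normSq_apply]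
  nlinarith [h3]

/-- Some increment direction carries a real part `≥ ‖P‖/√24` against any `P`. [folklore] -/
theorem exists_re_mvec_sq_ge (P : ℂ) : ∃ k : Fin 6, Complex.normSq P / 24 ≤ (mvec k * P).re ^ 2 := by
  have hf := re_sq_vecA_add P
  have e1 : (mvec 1 * P).re = (vecA * P).re / 2 := by
    simp [mvec, fvec, Complex.mul_re]; ring
  have e3 : (mvec 3 * P).re = (vecB * P).re / 2 := by
    simp [mvec, fvec, Complex.mul_re]; ring
  have e5 : (mvec 5 * P).re = (vecC * P).re / 2 := by
    simp [mvec, fvec, Complex.mul_re]; ring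
  by_contra h
  push Not at h
  have h1 := h 1; have h3' := h 3; have h5 := h 5
  rw [e1] at h1; rw [e3] at h3'; rw [e5] at h5
  nlinarith [Complex.normSq_nonneg P]

/-- **No interior maximum where the observable varies slowly** (the central-symmetry mechanism):
if the six values of `F = F_{x_c,5/8}` on the hexagon around an interior site `s` lie within
`η‖P‖` of a non-zero `P` with `18η² < 1` (`η < √2/6 ≈ 0.2357`), then some neighbouring site has
strictly larger `Re H` for every potential `H` of `F dz` — in fact the argument works in every
direction.  Proof: if all six real parts of the increments `m_k F_k` were `≤ 0`, then, opposite
increments summing to `m_k(F_k − F_{k+3})`, each `|Re(m_k F_k)| ≤ ‖m_k‖·2η‖P‖`, whence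
`|Re(m_k P)| ≤ 3‖m_k‖η‖P‖ = (√3/2)η‖P‖` for all `k`, contradicting the frame bound
`max_k |Re(m_k P)| ≥ ‖P‖/√24`. [folklore] -/
theorem noInteriorMax_of_oscillation {Λ : Finset HexVertex} {a : Sym2 HexVertex} {H : Site 2 → ℂ}
    (hH : IsPotential Λ a H) {s : Site 2} (hs : IsInteriorSite Λ s) {P : ℂ} (hP : P ≠ 0)
    {η : ℝ} (hη0 : 0 ≤ η) (hη : 18 * η ^ 2 < 1)
    (hosc : ∀ k : Fin 6,
      ‖hexParafermionicObservable Λ a hexCriticalFugacity (5 / 8) (HexKernel.edge s k) - P‖ ≤ η * ‖P‖) :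
    ∃ t ∈ siteNbrs s, (H s).re < (H t).re := by
  set F : Sym2 HexVertex → ℂ := hexParafermionicObservable Λ a hexCriticalFugacity (5 / 8) with hF
  by_contra hcon
  push Not at hcon
  -- the six increments and their signs
  have hw : ∀ k : Fin 6, H (spoke s k) - H s = mvec k * F (HexKernel.edge s k) := fun k => by
    rw [potential_spoke hH hs k, edgeValue, hexMidpoint_edge_sub]
  have hle : ∀ k : Fin 6, (mvec k * F (HexKernel.edge s k)).re ≤ 0 := fun k => by
    have := hcon (spoke s k) (spoke_mem_siteNbrs s k)
    rw [← hw, Complex.sub_re]; linarith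
  obtain ⟨k, hk⟩ := exists_re_mvec_sq_ge P
  -- notation
  set m : ℂ := mvec k with hm
  set Fk : ℂ := F (HexKernel.edge s k)
  set Fk' : ℂ := F (HexKernel.edge s (k + 3))
  have hm3 : mvec (k + 3) = -m := mvec_add_three k
  have hmsq : Complex.normSq m = 1 / 12 := normSq_mvec k
  have hp0 : 0 < ‖P‖ := norm_pos_iff.2 hP
  -- opposite increments: both real parts ≤ 0, their sum is `Re(m (Fk - Fk'))`
  have h1 : (m * Fk).re ≤ 0 := hle k
  have h2 : (-(m * Fk')).re ≤ 0 := by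
    have := hle (k + 3); rwa [hm3, neg_mul] at this
  have hdiff : ‖Fk - Fk'‖ ≤ 2 * η * ‖P‖ := by
    calc ‖Fk - Fk'‖ = ‖(Fk - P) - (Fk' - P)‖ := by ring_nf
      _ ≤ ‖Fk - P‖ + ‖Fk' - P‖ := norm_sub_le _ _
      _ ≤ η * ‖P‖ + η * ‖P‖ := add_le_add (hosc k) (hosc (k + 3))
      _ = 2 * η * ‖P‖ := by ring
  have hnormm : ‖m‖ ^ 2 = 1 / 12 := by
    rw [← Complex.normSq_eq_norm_sq]; exact hmsq
  have hm0 : 0 ≤ ‖m‖ := norm_nonneg _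
  -- |Re(m Fk)| ≤ ‖m‖ · 2η‖P‖
  have hA : -(m * Fk).re ≤ ‖m‖ * (2 * η * ‖P‖) := by
    have hsum : -(m * Fk).re ≤ -((m * Fk).re + (-(m * Fk')).re) := by linarith
    have hre : -((m * Fk).re + (-(m * Fk')).re) ≤ ‖m * (Fk - Fk')‖ := by
      have : (m * Fk).re + (-(m * Fk')).re = (m * (Fk - Fk')).re := by
        rw [mul_sub, Complex.sub_re, Complex.neg_re]; ring
      rw [this]
      exact (neg_le_abs _).trans (Complex.abs_re_le_norm _)
    calc -(m * Fk).re ≤ ‖m * (Fk - Fk')‖ := hsum.trans hre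
      _ = ‖m‖ * ‖Fk - Fk'‖ := norm_mul _ _
      _ ≤ ‖m‖ * (2 * η * ‖P‖) := mul_le_mul_of_nonneg_left hdiff hm0
  -- |Re(m (Fk - P))| ≤ ‖m‖ η ‖P‖
  have hB : |(m * (Fk - P)).re| ≤ ‖m‖ * (η * ‖P‖) := by
    calc |(m * (Fk - P)).re| ≤ ‖m * (Fk - P)‖ := Complex.abs_re_le_norm _
      _ = ‖m‖ * ‖Fk - P‖ := norm_mul _ _
      _ ≤ ‖m‖ * (η * ‖P‖) := mul_le_mul_of_nonneg_left (hosc k) hm0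
  -- hence |Re(m P)| ≤ 3 ‖m‖ η ‖P‖
  have hsplit : (m * P).re = (m * Fk).re - (m * (Fk - P)).re := by
    rw [mul_sub, Complex.sub_re]; ring
  have hC : |(m * P).re| ≤ 3 * ‖m‖ * (η * ‖P‖) := by
    rw [abs_le]
    constructor
    · have := (abs_le.1 hB).2
      nlinarith [h1, hA, hsplit]
    · have := (abs_le.1 hB).1
      nlinarith [h1, hA, hsplit]
  -- square and compare with the frame bound
  have hsq : (m * P).re ^ 2 ≤ (3 * ‖m‖ * (η * ‖P‖)) ^ 2 := by
    have h0 : 0 ≤ 3 * ‖m‖ * (η * ‖P‖) := by positivity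
    exact sq_le_sq' (by linarith [(abs_le.1 hC).1]) (abs_le.1 hC).2
  have hPn : Complex.normSq P = ‖P‖ ^ 2 := Complex.normSq_eq_norm_sq P
  rw [hPn] at hk
  have hexp : (3 * ‖m‖ * (η * ‖P‖)) ^ 2 = 9 * ‖m‖ ^ 2 * η ^ 2 * ‖P‖ ^ 2 := by ring
  rw [hexp, hnormm] at hsq
  have hP2 : 0 < ‖P‖ ^ 2 := by positivity
  nlinarith [hk, hsq, hP2, hη]

/-- Registered sub-goal `stub_halfPlaneInputs_oscillation` of crux stmt-CriticalPhenomena-14004 (line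
`pick-half-plane`, interior half `HexNoInteriorMax` of `stub_halfPlaneInputs`): the closed form of
`noInteriorMax_of_oscillation`. [folklore] -/
theorem stub_halfPlaneInputs_oscillation : ∀ (Λ : Finset HexVertex) (a : Sym2 HexVertex) (H : Site 2 → ℂ), IsPotential Λ a H → ∀ (s : Site 2), IsInteriorSite Λ s → ∀ (P : ℂ), P ≠ 0 → ∀ (η : ℝ), 0 ≤ η → 18 * η ^ 2 < 1 → (∀ k : Fin 6, ‖hexParafermionicObservable Λ a hexCriticalFugacity (5 / 8) (HexKernel.edge s k) - P‖ ≤ η * ‖P‖) → ∃ t ∈ siteNbrs s, (H s).re < (H t).re :=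
  fun _ _ _ hH _ hs _ hP _ hη0 hη hosc => noInteriorMax_of_oscillation hH hs hP hη0 hη hosc

end Summit.CriticalPhenomena.SAWScalingLimit.Theorems.PickHalfPlane.Hexagon
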